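import Mathlib.RingTheory.Smooth.Locus
import Mathlib.RingTheory.FinitePresentation
import Mathlib.RingTheory.Localization.FractionRing
import Mathlib.Algebra.Algebra.Rat
import Literature.NumberTheory.Transcendental.DerivationExtension
import HarnessLib

/-!
# EL♮(3) / EL♮(n), RUNG LC «large characteristic» — brick (B4): SMOOTH-BASE SHRINK (pre-draft, res-type-027 g26; NOT filed without a desk GO)

`exists_formallySmooth_away_of_charZero`: a domain `A` of finite type over `ℤ` with `CharZero A` has `a ≠ 0` with `A[1/a]` formally smooth
(hence smooth) over `ℤ`.  Statement owner idea-2 g32 (rh STATUS l.≈39707, exact shape); levers: generic point smooth (`Frac A ⊇ ℚ`, char 0: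
✓ `Literature.NumberTheory.Transcendental.formallySmooth_of_charZero ℚ (Frac A)`, `FormallySmooth ℤ ℚ` by localisation, `FormallySmooth.comp`),
openness of the smooth locus of a finitely presented algebra (Mathlib `Algebra.isOpen_smoothLocus`, `Algebra.basicOpen_subset_smoothLocus_iff`;
pattern of ✓ `Literature.AlgebraicGeometry.Resolution.exists_formallySmooth_away`, base generalised from a field to any ring).
[OURS · counted 0 · EL♮(3) NOT proved · AI-written] [folklore]
-/

set_option linter.dupNamespace false

noncomputable section

namespace Summit.ResolutionOfSingularities.ResolutionOfSingularities.Cruxes.EquisingularLiftNat.Sections.LargeChar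

/-- **A smooth point of a finitely presented algebra has a formally smooth basic open neighbourhood** (openness of the smooth locus; ✓
`Literature.AlgebraicGeometry.Resolution.exists_formallySmooth_away` with the base field replaced by an arbitrary ring). [folklore] -/
theorem exists_formallySmooth_away_of_isSmoothAt {R N : Type*} [CommRing R] [CommRing N] [Algebra R N]
    [Algebra.FinitePresentation R N] (𝔭 : Ideal N) [𝔭.IsPrime] (h : Algebra.IsSmoothAt R 𝔭) :
    ∃ g : N, g ∉ 𝔭 ∧ Algebra.FormallySmooth R (Localization.Away g) := by
  have hmem : (⟨𝔭, inferInstance⟩ : PrimeSpectrum N) ∈ Algebra.smoothLocus R N := h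
  obtain ⟨_, ⟨g, rfl⟩, hg𝔭, hgsub⟩ :=
    PrimeSpectrum.isTopologicalBasis_basic_opens.exists_subset_of_mem_open hmem Algebra.isOpen_smoothLocus
  exact ⟨g, hg𝔭, Algebra.basicOpen_subset_smoothLocus_iff.mp hgsub⟩

/-- **The generic point of a characteristic-zero domain is a smooth point over `ℤ`**: `A_{(0)} = Frac A` is a field containing `ℚ`, formally
smooth over `ℚ` (characteristic zero: separably generated, ✓ `formallySmooth_of_charZero`) and `ℚ = ℤ_{(0)}` is formally smooth over `ℤ`.
[folklore] -/
theorem isSmoothAt_bot_int (A : Type*) [CommRing A] [IsDomain A] [CharZero A] : Algebra.IsSmoothAt ℤ (⊥ : Ideal A) := by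
  set L := Localization.AtPrime (⊥ : Ideal A)
  haveI : IsFractionRing A L := by
    change IsLocalization (nonZeroDivisors A) L
    rw [← Ideal.primeCompl_bot]
    infer_instance
  letI : Field L := IsFractionRing.toField A
  haveI : CharZero L := charZero_of_injective_algebraMap (IsFractionRing.injective A L)
  -- the `ℤ`-algebra structure on `L` found by inference is the localisation's; any two ring maps out of `ℤ` agree
  haveI := IsScalarTower.of_algebraMap_eq' (R := ℤ) (S := ℚ) (A := L) (Subsingleton.elim _ _)
  haveI : Algebra.FormallySmooth ℤ ℚ := Algebra.FormallySmooth.of_isLocalization (nonZeroDivisors ℤ)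
  haveI : Algebra.FormallySmooth ℚ L := Literature.NumberTheory.Transcendental.formallySmooth_of_charZero ℚ L
  change Algebra.FormallySmooth ℤ L
  exact Algebra.FormallySmooth.comp ℤ ℚ L

/-- ★ **(B4) SMOOTH-BASE SHRINK.**  A domain `A` of finite type over `ℤ` of characteristic zero has a non-zero `a` with `A[1/a]` formally smooth over
`ℤ` (so smooth: finitely presented).  Where it plugs into RUNG LC: at a characteristic-zero point `𝔮` of `Spec ℤ[c]` the base of `hspread` is
`(ℤ[c] ⧸ 𝔮)[1/f]` — a domain, of finite type over `ℤ`, `CharZero` because `𝔮` contains no rational prime — and this lemma supplies the extra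
shrink making it `ℤ`-smooth, as `DescDoorSharp` (N := 1) wants. [OURS · counted 0] [folklore] -/
theorem exists_formallySmooth_away_of_charZero (A : Type) [CommRing A] [IsDomain A] [CharZero A] [Algebra.FiniteType ℤ A] :
    ∃ a : A, a ≠ 0 ∧ Algebra.FormallySmooth ℤ (Localization.Away a) := by
  haveI : Algebra.FinitePresentation ℤ A := (Algebra.FinitePresentation.of_finiteType).mp ‹_›
  obtain ⟨a, ha, h⟩ := exists_formallySmooth_away_of_isSmoothAt (R := ℤ) (⊥ : Ideal A) (isSmoothAt_bot_int A)
  exact ⟨a, mt Ideal.mem_bot.mpr ha, h⟩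

/-- (B4) in the `Algebra.Smooth` currency (formally smooth + finitely presented). [OURS · counted 0] [folklore] -/
theorem exists_smooth_away_of_charZero (A : Type) [CommRing A] [IsDomain A] [CharZero A] [Algebra.FiniteType ℤ A] :
    ∃ a : A, a ≠ 0 ∧ Algebra.Smooth ℤ (Localization.Away a) := by
  obtain ⟨a, ha, h⟩ := exists_formallySmooth_away_of_charZero A
  haveI : Algebra.FinitePresentation ℤ A := (Algebra.FinitePresentation.of_finiteType).mp ‹_›
  haveI : Algebra.FinitePresentation ℤ (Localization.Away a) :=
    Algebra.FinitePresentation.trans ℤ A (Localization.Away a)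
  exact ⟨a, ha, ⟨h, inferInstance⟩⟩

end Summit.ResolutionOfSingularities.ResolutionOfSingularities.Cruxes.EquisingularLiftNat.Sections.LargeChar

end
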